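import Mathlib
import Summits.Ventures.HodgeRepro2.MultiplicityOnePeriod

/-!
# HodgePeriodHeckeSymmetry — Hecke operators are adjoint for the Hodge period pairing:
`∫_D ω_{T_δ f} ∧ conj ω_g = ∫_D ω_f ∧ conj ω_{T_{δ⁻¹} g}`

Blind cell `pub-hodge-repro2`, seat p2 (Tier 5 kernel support).

The Hodge pairing of two weight-`3` forms is `4 ×` their Petersson product
(`MultiplicityOnePeriod.setIntegral_hodgeWedge_eq_inner_mk`), and `(T_δ, T_{δ⁻¹})` is a formal
adjoint pair for the Petersson product (`PeterssonSpace.inner_heckeForms_adjoint`). Hence the Hecke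
operators move across the Hodge period pairing with `δ ↦ δ⁻¹`:

* **`setIntegral_hodgeWedge_heckeForms_left`**:
  `∫_{D} ω_{T_δ f} ∧ conj ω_g = ∫_{D} ω_f ∧ conj ω_{T_{δ⁻¹} g}`;
* **`setIntegral_hodgeWedge_heckeForms_self_adjoint`**: when `T_δ = T_{δ⁻¹}` on the forms
  (e.g. `δ⁻¹ ∈ SδS`), `∫_{D} ω_{T_δ f} ∧ conj ω_g = ∫_{D} ω_f ∧ conj ω_{T_δ g}`.
-/

namespace Summit.Ventures.HodgeRepro2.ShimuraData

open MeasureTheory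

variable {K : Type*} [Field K] [NumberField K] [NumberField.IsCMField K] {τ₁ : K →+* ℂ}
  {H : Matrix (Fin 3) (Fin 3) K} {Q : Matrix (Fin 3) (Fin 3) ℂ} (hQ : IsFrame K τ₁ H Q)
  (S : Subgroup (GL (Fin 3) K)) (hS : (S : Set (GL (Fin 3) K)) ⊆ unitaryGroup K H)
  [CompactSpace (ballQuotient hQ S hS)] {D : Set ball₂}
  (hD : IsBallFundamentalDomain hQ S hS D) (hDm : MeasurableSet D)
  {δ : GL (Fin 3) K} (hδ : δ ∈ unitaryGroup K H)
  [Fintype (S ⧸ (heckeSubgroup S δ).subgroupOf S)]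
  [Fintype (S ⧸ (heckeSubgroup S δ⁻¹).subgroupOf S)]

include hDm in
/-- **Hecke adjointness for the Hodge period pairing**:
`∫_D ω_{T_δ f} ∧ conj ω_g = ∫_D ω_f ∧ conj ω_{T_{δ⁻¹} g}`. -/
theorem setIntegral_hodgeWedge_heckeForms_left (f g : PeterssonForms hQ S hS 3 hD) :
    ∫ x in Subtype.val '' D,
        hodgeWedge (PeterssonForms.toForm hQ S hS 3 hD (heckeForms hQ S hS 3 hD hδ f))
          (PeterssonForms.toForm hQ S hS 3 hD g) x
      = ∫ x in Subtype.val '' D,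
        hodgeWedge (PeterssonForms.toForm hQ S hS 3 hD f)
          (PeterssonForms.toForm hQ S hS 3 hD (heckeForms hQ S hS 3 hD (inv_mem hδ) g)) x := by
  rw [setIntegral_hodgeWedge_eq_inner_mk hQ S hS hD hDm, setIntegral_hodgeWedge_eq_inner_mk hQ S hS hD hDm]
  congr 1
  -- `⟪g, T_δ f⟫ = ⟪T_{δ⁻¹} g, f⟫` from `⟪T_δ f, g⟫ = ⟪f, T_{δ⁻¹} g⟫` by conjugate symmetry
  change inner ℂ g (heckeForms hQ S hS 3 hD hδ f) = inner ℂ (heckeForms hQ S hS 3 hD (inv_mem hδ) g) f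
  rw [← inner_conj_symm, inner_heckeForms_adjoint hQ S hS 3 hD hδ hDm f g, inner_conj_symm]

include hDm in
/-- When `T_δ = T_{δ⁻¹}` on the forms, `T_δ` is self-adjoint for the Hodge period pairing. -/
theorem setIntegral_hodgeWedge_heckeForms_self_adjoint
    (hself : heckeForms hQ S hS 3 hD hδ = heckeForms hQ S hS 3 hD (inv_mem hδ))
    (f g : PeterssonForms hQ S hS 3 hD) :
    ∫ x in Subtype.val '' D,
        hodgeWedge (PeterssonForms.toForm hQ S hS 3 hD (heckeForms hQ S hS 3 hD hδ f))
          (PeterssonForms.toForm hQ S hS 3 hD g) x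
      = ∫ x in Subtype.val '' D,
        hodgeWedge (PeterssonForms.toForm hQ S hS 3 hD f)
          (PeterssonForms.toForm hQ S hS 3 hD (heckeForms hQ S hS 3 hD hδ g)) x := by
  rw [setIntegral_hodgeWedge_heckeForms_left hQ S hS hD hDm hδ f g, ← hself]

end Summit.Ventures.HodgeRepro2.ShimuraData
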